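import Summits.Ventures.LatticeQCDFlow.Scaling.SpiderSharpLaw
import Summits.Ventures.LatticeQCDFlow.Scaling.GraphSchemeSpectralGap

/-!
HONEST FRAMING: exact (Metropolis-corrected) sampling algorithms for lattice gauge theory; figures
of merit are autocorrelation/cost numbers at stated couplings and volumes; no continuum-physics
claim.

# ExchangeSplitBudget — NO SPLIT OF A STEP BETWEEN SWAPPING (`t`) AND UPDATING (`1−t`) BEATS THE SUM OF THE TWO BUDGETS: `max{A/t, B/(1−t)} ≥ A + B` FOR EVERY `t ∈ (0,1)`, WITH EQUALITY AT
# `t = A/(A+B)`; HENCE THE RELAXATION TIME `1/γ = 1/ρ_G` OF THE HOMOGENEOUS LADDER IS `≥ K(K+1)(2K+1)/6 + (K+1)/w_0` FOR EVERY `t`, THE STAR'S `≥ K + (K+1)/w_0`, THE SPIDER'S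
# `≥ bℓ(ℓ+1)(2ℓ+1)/6 + (bℓ+1)/w_0` (lean-2 GEN-48, ours)

Venture-side (OURS).  Cell `lqcd-flow` (pub-lqcd), unit `pub-lqcd-lean-2-g48`, 2026-09-01.  Chapter AI (the sizes of the Robin ground state), file 15 — parents AI14 `SpiderSharpLaw` (AI6 ladder, AI5 star),
AI10 `GraphSchemeSpectralGap` (`γ = ρ`).  The two-sided windows of the chapter have the form `max{A/t, B/h} ≤ 1/ρ` with `h = (1−t)w_0`: a transport budget paid from the swap probability `t` and a
refresh budget paid from the update probability `1−t`.  (§1) For `0 < t < 1`: `A + B ≤ max{A/t, B/(1−t)}` (if `A/t < A+B` then `t > A/(A+B)`, so `B/(1−t) > A+B`), and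
`t⋆ = A/(A+B)` achieves equality — the cost-optimal split of one step, value-free.  (§2) With AI10's `γ(P) = ρ`: **for every swap probability `t` the spectral gap of the homogeneous ladder is at
most `1/(K(K+1)(2K+1)/6 + (K+1)/w_0)`**, the star's at most `1/(K + (K+1)/w_0)`, the spider's at most `1/(bℓ(ℓ+1)(2ℓ+1)/6 + (bℓ+1)/w_0)` — the two budgets ADD, whatever the tuning; the
`t`-free statement a cost accounting can quote.  No definitions.

* §1 `add_le_max_div_split`, `max_div_split_eq_add`; §2 `homLadder_relax_ge_sum`, `homStar_relax_ge_sum`, `homSpider_relax_ge_sum`.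

Literature grade (cell rule): OWN (elementary); nothing cited; no new bib keys.
-/

noncomputable section

open Finset Function
open Literature.Probability.MarkovChains

namespace Summit.Ventures.LatticeQCDFlow.Scaling

/-! ## §1 The split inequality -/

/-- **`A + B ≤ max{A/t, B/(1−t)}` for `0 < t < 1` (any real `A, B`).** [ours] -/
theorem add_le_max_div_split {A B t : ℝ} (ht0 : 0 < t) (ht1 : t < 1) : A + B ≤ max (A / t) (B / (1 - t)) := by
  have h1t : 0 < 1 - t := by linarith
  by_cases h : A + B ≤ A / t
  · exact le_trans h (le_max_left _ _)
  · push Not at h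
    -- `A < t(A+B)`, so `(1−t)(A+B) < B`
    have h2 : A < (A + B) * t := by rwa [div_lt_iff₀ ht0] at h
    have h3 : (A + B) * (1 - t) ≤ B := by nlinarith
    exact le_trans ((le_div_iff₀ h1t).mpr h3) (le_max_right _ _)

/-- **The optimal split:** `A, B > 0`, `t⋆ = A/(A+B)` ⇒ `0 < t⋆ < 1` and `max{A/t⋆, B/(1−t⋆)} = A + B`. [ours] -/
theorem max_div_split_eq_add {A B : ℝ} (hA : 0 < A) (hB : 0 < B) :
    0 < A / (A + B) ∧ A / (A + B) < 1 ∧ max (A / (A / (A + B))) (B / (1 - A / (A + B))) = A + B := by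
  have hAB : 0 < A + B := by linarith
  refine ⟨div_pos hA hAB, (div_lt_one hAB).mpr (by linarith), ?_⟩
  have h1 : A / (A / (A + B)) = A + B := by field_simp
  have h2 : B / (1 - A / (A + B)) = A + B := by
    have : 1 - A / (A + B) = B / (A + B) := by field_simp; ring
    rw [this]; field_simp
  rw [h1, h2, max_self]

/-! ## §2 The budgets add -/

variable {S : Type*} [Fintype S] [DecidableEq S] [Nontrivial S] {ν : S → ℝ} {t : ℝ}

section Ladder
variable {K : ℕ} {M : Fin (K + 1) → S → S → ℝ} {w : Fin (K + 1) → ℝ} {P : (Fin (K + 1) → S) → (Fin (K + 1) → S) → ℝ}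

/-- **THE LADDER'S BUDGETS ADD:** for the homogeneous ladder `t·ptBareSwap ν^{⊗} + (1−t)·prodKernel w M` (one positive law, exact hot sampler, idle cold kernels, `K ≥ 1`, `|S| ≥ 2`) and EVERY
`0 < t < 1`: **`γ(P)·(K(K+1)(2K+1)/6 + (K+1)/w_0) ≤ 1`**. [ours] -/
theorem homLadder_relax_ge_sum (hK : 1 ≤ K) (hν : ∀ v, 0 < ν v) (hν1 : ∑ v, ν v = 1) (hM0 : ∀ u v, M 0 u v = ν v)
    (hidle : ∀ i : Fin K, ∀ u v, M i.succ u v = if v = u then 1 else 0) (hw0 : ∀ k, 0 ≤ w k) (hw00 : 0 < w 0) (hw1 : ∑ k, w k = 1) (ht0 : 0 < t) (ht1 : t < 1)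
    (hP : ∀ x y, P x y = t * ptBareSwap (fun _ : Fin (K + 1) => ν) x y + (1 - t) * prodKernel w M x y) :
    spectralGap (tensorFun (fun _ : Fin (K + 1) => ν)) P * ((K : ℝ) * (K + 1) * (2 * K + 1) / 6 + ((K : ℝ) + 1) / w 0) ≤ 1 := by
  have hKpos : (0 : ℝ) < K := Nat.cast_pos.mpr (by omega)
  have hhh : 0 < (1 - t) * w 0 := mul_pos (by linarith) hw00
  set eK : Fin K → Fin (K + 1) × Fin (K + 1) := fun j => (j.castSucc, j.succ) with heK
  have he : ∀ r, (eK r).1 ≠ (eK r).2 := fun r => ne_of_lt Fin.castSucc_lt_succ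
  have hP' : ∀ x y, P x y = t * ptGraphSwap (fun _ : Fin (K + 1) => ν) eK (fun _ => Equiv.refl S) x y + (1 - t) * prodKernel w M x y := by
    intro x y; rw [hP, heK, ptGraphSwap_pathList_eq]
  obtain ⟨ρ, c, hρ0, _, hcpos, _, hvertex, hgap⟩ := graphScheme_spectralGap_exists eK hK he pathList_connected hν hν1 hM0 hidle hw0 hw00 hw1 ht0 ht1 hP'
  rw [hgap]
  have hlin := pathList_rho_le_linear hK ht0.le hcpos hvertex
  have hhot := groundState_rho_le_hot eK hcpos ht0.le hvertex
  -- `1/ρ ≥ A/t` and `1/ρ ≥ B/(1−t)` with `A = K(K+1)(2K+1)/6`, `B = (K+1)/w_0`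
  have hA : (K : ℝ) * (K + 1) * (2 * K + 1) / 6 / t ≤ 1 / ρ := by
    rw [div_le_div_iff₀ ht0 hρ0, one_mul]
    have := hlin; rw [le_div_iff₀ (by positivity)] at this
    linarith
  have hB : ((K : ℝ) + 1) / w 0 / (1 - t) ≤ 1 / ρ := by
    rw [div_div, div_le_div_iff₀ (by nlinarith) hρ0, one_mul]
    nlinarith
  have hsum := add_le_max_div_split (A := (K : ℝ) * (K + 1) * (2 * K + 1) / 6) (B := ((K : ℝ) + 1) / w 0) ht0 ht1
  have hmax : max ((K : ℝ) * (K + 1) * (2 * K + 1) / 6 / t) (((K : ℝ) + 1) / w 0 / (1 - t)) ≤ 1 / ρ := max_le hA hB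
  have h1 := le_trans hsum hmax
  rw [le_div_iff₀ hρ0] at h1
  linarith

end Ladder

section Star
variable {K m : ℕ} (κ : Fin m → Fin K) {M : Fin (K + 1) → S → S → ℝ} {w : Fin (K + 1) → ℝ} {P : (Fin (K + 1) → S) → (Fin (K + 1) → S) → ℝ}

/-- **THE STAR'S BUDGETS ADD:** uniform hub list (`c ≥ 1` copies of each hub edge, `m = cK`), `K ≥ 1`, `|S| ≥ 2`, one positive law, exact hot sampler, idle cold kernels, EVERY `0 < t < 1`:
**`γ(P)·(K + (K+1)/w_0) ≤ 1`**. [ours] -/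
theorem homStar_relax_ge_sum (hK : 1 ≤ K) (hm : 1 ≤ m) {cc : ℕ} (hcc : 1 ≤ cc) (hunif : ∀ i : Fin K, (univ.filter fun r : Fin m => κ r = i).card = cc)
    (hmc : m = cc * K) (hν : ∀ v, 0 < ν v) (hν1 : ∑ v, ν v = 1) (hM0 : ∀ u v, M 0 u v = ν v) (hidle : ∀ i : Fin K, ∀ u v, M i.succ u v = if v = u then 1 else 0)
    (hw0 : ∀ k, 0 ≤ w k) (hw00 : 0 < w 0) (hw1 : ∑ k, w k = 1) (ht0 : 0 < t) (ht1 : t < 1)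
    (hP : ∀ x y, P x y = t * ptGraphSwap (fun _ : Fin (K + 1) => ν) (fun r : Fin m => (((0 : Fin (K + 1)), (κ r).succ) : Fin (K + 1) × Fin (K + 1))) (fun _ => Equiv.refl S) x y
      + (1 - t) * prodKernel w M x y) :
    spectralGap (tensorFun (fun _ : Fin (K + 1) => ν)) P * ((K : ℝ) + ((K : ℝ) + 1) / w 0) ≤ 1 := by
  have hKpos : (0 : ℝ) < K := Nat.cast_pos.mpr (by omega)
  have hhh : 0 < (1 - t) * w 0 := mul_pos (by linarith) hw00
  have he : ∀ r : Fin m, ((fun r : Fin m => (((0 : Fin (K + 1)), (κ r).succ) : Fin (K + 1) × Fin (K + 1))) r).1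
      ≠ ((fun r : Fin m => (((0 : Fin (K + 1)), (κ r).succ) : Fin (K + 1) × Fin (K + 1))) r).2 := fun r => (Fin.succ_ne_zero (κ r)).symm
  -- the star's explicit mode (AH3) and `γ = ρ`
  obtain ⟨x, hx0, hx1, hx⟩ := starMode_exists hK ht0 hhh
  set ρ : ℝ := t * (1 - x) / K with hρ
  obtain ⟨_, hρ0, hρt, hρh, _⟩ := starMode_rho_bounds hK ht0 hhh hx0 hx1 hx hρ
  set c : Fin (K + 1) → ℝ := fun k => if k = 0 then x else 1 with hc
  have hc0 : c 0 = x := by rw [hc]; simp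
  have hck : ∀ i : Fin K, c i.succ = 1 := fun i => by rw [hc]; simp [Fin.succ_ne_zero]
  have hcpos : ∀ k, 0 < c k := fun k => by rw [hc]; dsimp only; split_ifs <;> linarith
  have hvertex0 := star_vertex_equations κ (t := t) hK hcc hunif hmc hc0 hck hρ hx
  have hvertex : ∀ k : Fin (K + 1), t / m * ∑ r : Fin m,
      ((if k = ((fun r : Fin m => (((0 : Fin (K + 1)), (κ r).succ) : Fin (K + 1) × Fin (K + 1))) r).1
        then c ((fun r : Fin m => (((0 : Fin (K + 1)), (κ r).succ) : Fin (K + 1) × Fin (K + 1))) r).2 - c ((fun r : Fin m => (((0 : Fin (K + 1)), (κ r).succ) : Fin (K + 1) × Fin (K + 1))) r).1 else 0)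
      + (if k = ((fun r : Fin m => (((0 : Fin (K + 1)), (κ r).succ) : Fin (K + 1) × Fin (K + 1))) r).2
        then c ((fun r : Fin m => (((0 : Fin (K + 1)), (κ r).succ) : Fin (K + 1) × Fin (K + 1))) r).1 - c ((fun r : Fin m => (((0 : Fin (K + 1)), (κ r).succ) : Fin (K + 1) × Fin (K + 1))) r).2 else 0))
      - (if k = 0 then (1 - t) * w 0 * c k else 0) = -ρ * c k := by
    intro k
    have := hvertex0 k
    by_cases hk : k = 0
    · subst hk; exact this
    · rw [if_neg hk] at this ⊢; exact this
  have hgap := graphScheme_spectralGap_eq (fun r : Fin m => (((0 : Fin (K + 1)), (κ r).succ) : Fin (K + 1) × Fin (K + 1))) hm he hν hν1 hM0 hidle hw0 hw00 hw1 ht0 ht1 hP hρ0 hcpos hvertex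
  rw [hgap]
  have hA : (K : ℝ) / t ≤ 1 / ρ := by
    rw [div_le_div_iff₀ ht0 hρ0, one_mul]
    calc (K : ℝ) * ρ ≤ K * (t / K) := mul_le_mul_of_nonneg_left hρt hKpos.le
      _ = t := by field_simp
  have hB : ((K : ℝ) + 1) / w 0 / (1 - t) ≤ 1 / ρ := by
    rw [div_div, div_le_div_iff₀ (by nlinarith) hρ0, one_mul]
    calc ((K : ℝ) + 1) * ρ ≤ ((K : ℝ) + 1) * ((1 - t) * w 0 / ((K : ℝ) + 1)) := mul_le_mul_of_nonneg_left hρh (by linarith)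
      _ = w 0 * (1 - t) := by field_simp
  have hsum := add_le_max_div_split (A := (K : ℝ)) (B := ((K : ℝ) + 1) / w 0) ht0 ht1
  have h1 := le_trans hsum (max_le hA hB)
  rw [le_div_iff₀ hρ0] at h1
  linarith

end Star

section Spider
variable {b ℓ : ℕ} {M : Fin (b * ℓ + 1) → S → S → ℝ} {w : Fin (b * ℓ + 1) → ℝ} {P : (Fin (b * ℓ + 1) → S) → (Fin (b * ℓ + 1) → S) → ℝ}

/-- **THE SPIDER'S BUDGETS ADD:** `b` ladders of length `ℓ` sharing the hot seat (`b, ℓ ≥ 1`, `|S| ≥ 2`, one positive law, exact hot sampler, idle cold kernels), EVERY `0 < t < 1`: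
**`γ(P)·(bℓ(ℓ+1)(2ℓ+1)/6 + (bℓ+1)/w_0) ≤ 1`**. [ours] -/
theorem homSpider_relax_ge_sum (hb : 1 ≤ b) (hℓ : 1 ≤ ℓ) (hν : ∀ v, 0 < ν v) (hν1 : ∑ v, ν v = 1) (hM0 : ∀ u v, M 0 u v = ν v)
    (hidle : ∀ i : Fin (b * ℓ), ∀ u v, M i.succ u v = if v = u then 1 else 0) (hw0 : ∀ k, 0 ≤ w k) (hw00 : 0 < w 0) (hw1 : ∑ k, w k = 1) (ht0 : 0 < t) (ht1 : t < 1)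
    (hP : ∀ x y, P x y = t * ptGraphSwap (fun _ : Fin (b * ℓ + 1) => ν)
        (fun r : Fin (b * ℓ) => ((if (r : ℕ) % ℓ = 0 then (0 : Fin (b * ℓ + 1)) else r.castSucc, r.succ) : Fin (b * ℓ + 1) × Fin (b * ℓ + 1))) (fun _ => Equiv.refl S) x y
      + (1 - t) * prodKernel w M x y) :
    spectralGap (tensorFun (fun _ : Fin (b * ℓ + 1) => ν)) P * (((b * ℓ : ℕ) : ℝ) * ((ℓ : ℝ) + 1) * (2 * ℓ + 1) / 6 + (((b * ℓ : ℕ) : ℝ) + 1) / w 0) ≤ 1 := by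
  have hbl : 1 ≤ b * ℓ := Nat.one_le_iff_ne_zero.mpr (Nat.mul_ne_zero (by omega) (by omega))
  have hKpos : (0 : ℝ) < ((b * ℓ : ℕ) : ℝ) := Nat.cast_pos.mpr (by omega)
  have hhh : 0 < (1 - t) * w 0 := mul_pos (by linarith) hw00
  obtain ⟨ρ, c, hρ0, _, hcpos, _, hvertex, hgap⟩ := graphScheme_spectralGap_exists
    (fun r : Fin (b * ℓ) => ((if (r : ℕ) % ℓ = 0 then (0 : Fin (b * ℓ + 1)) else r.castSucc, r.succ) : Fin (b * ℓ + 1) × Fin (b * ℓ + 1)))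
    hbl (spiderList_ne (b := b) (ℓ := ℓ)) (spiderList_connected hℓ) hν hν1 hM0 hidle hw0 hw00 hw1 ht0 ht1 hP
  rw [hgap]
  have hlin := spiderList_rho_le_linear hb hℓ ht0.le hcpos hvertex
  have hhot := groundState_rho_le_hot _ hcpos ht0.le hvertex
  have hA : ((b * ℓ : ℕ) : ℝ) * ((ℓ : ℝ) + 1) * (2 * ℓ + 1) / 6 / t ≤ 1 / ρ := by
    rw [div_le_div_iff₀ ht0 hρ0, one_mul]
    have := hlin; rw [le_div_iff₀ (by positivity)] at this
    linarith
  have hB : (((b * ℓ : ℕ) : ℝ) + 1) / w 0 / (1 - t) ≤ 1 / ρ := by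
    rw [div_div, div_le_div_iff₀ (by nlinarith) hρ0, one_mul]
    nlinarith
  have hsum := add_le_max_div_split (A := ((b * ℓ : ℕ) : ℝ) * ((ℓ : ℝ) + 1) * (2 * ℓ + 1) / 6) (B := (((b * ℓ : ℕ) : ℝ) + 1) / w 0) ht0 ht1
  have h1 := le_trans hsum (max_le hA hB)
  rw [le_div_iff₀ hρ0] at h1
  linarith

end Spider

end Summit.Ventures.LatticeQCDFlow.Scaling

end
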